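import Literature.Geometry.Manifold.FlowBoxFlow
import Summits.FinalStateConjecture.FinalStateConjecture.Theorems.ZeroEnergyKerrOrBombHawkingExtensionIsKerrCollarSurfaceGravityPointwise
import HarnessLib

/-!
# Crux `HawkingExtensionIsKerr` (stmt-FinalStateConjecture-17840), line `SketchIdeator2` —
# collar zeroth law, step B: near a non-degenerate point the horizon is the level set `{g(K,K) = 0}`

Helper file of the line lead (c3), programme "collar zeroth law".  For the Killing–timelike
collar `(U, K)` of the crux (`K` Killing on an open `U ⊇ 𝓔⁺`, null on `𝓔⁺`, timelike on
`U ∩ ⟨⟨M_ext⟩⟩`) and a horizon point `p` with `∇_K K = κ K`, `κ ≠ 0`, every zero of `f = g(K, K)`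
close enough to `p` lies on `𝓔⁺` (`eventually_mem_horizon_of_val_self_eq_zero`).  Proof: (1) the
collar forces `df_p(v) ≥ 0` on future-timelike `v` (as in step A), and `df_p = -2κ g(K_p, ·) ≠ 0`
there, so `f` increases along the time-orientation field `Y` at `p`, hence near `p`; (2) in a flow
box of `Y` about `p` (Lee 2012, Thm. 9.22; tree `exists_chart_mfderiv_eq_const`) the coordinate
lines are integral curves of `Y`, i.e. future timelike curves along which `f` is strictly
increasing; (3) for a zero `y` of `f` near `p`, follow its line to the past into `I⁻(M_ext)` and
take the last parameter at which the line is in the closure of `I⁻(M_ext)`: that point is a horizon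
point, where `f = 0` — impossible strictly before `y` by monotonicity — so it is `y` itself.
-/

noncomputable section

set_option linter.dupNamespace false

namespace Summit.FinalStateConjecture.FinalStateConjecture.Theorems.HawkingExtensionIsKerr.SketchIdeator2

open Set Function Filter Metric Bundle Literature.Geometry.Lorentzian Literature.Geometry.Manifold
open scoped Manifold ContDiff Topology

/-- Velocity of a curve with a prescribed manifold derivative. [folklore] -/
theorem velocity_eq_of_hasMFDerivAt' {M : Type*} [TopologicalSpace M] [ChartedSpace E4 M]
    {γ : ℝ → M} {t : ℝ} {w : TangentSpace (𝓡 4) (γ t)}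
    (h : HasMFDerivAt 𝓘(ℝ, ℝ) (𝓡 4) γ t ((1 : ℝ →L[ℝ] ℝ).smulRight w)) :
    velocity (𝓡 4) γ t = w := by
  unfold velocity
  rw [h.mfderiv]
  change ((1 : ℝ →L[ℝ] ℝ) (1 : ℝ)) • w = w
  rw [show ((1 : ℝ →L[ℝ] ℝ) (1 : ℝ)) = 1 from rfl, one_smul]

/-- **Step B1: the collar makes `f = g(K, K)` increase to the future at horizon points.**  For the
collar `(U, K)` (Killing on `U ⊇ 𝓔⁺`, null on `𝓔⁺`, `g(K,K) ≤ 0` on `U ∩ ⟨⟨M_ext⟩⟩`) and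
`p ∈ 𝓔⁺`: `2 g(∇_v K, K_p) ≥ 0` for every future-timelike `v` at `p` (the one-sided derivative of
`f` along a timelike curve dipping into `I⁻(p) ⊆ ⟨⟨M_ext⟩⟩`, as in step A). -/
theorem two_mul_val_leviCivita_self_nonneg_of_collar (𝓑 : StationaryAFBlackHole.{0})
    [𝓑.metric.HasLeviCivita] {U : Set 𝓑.carrier} {K : Π x : 𝓑.carrier, TangentSpace (𝓡 4) x}
    (hU : IsOpen U) (hHU : 𝓑.horizon ⊆ U)
    (hKon : 𝓑.metric.toPseudoRiemannianMetric.IsKillingFieldOn K U)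
    (hnull : ∀ p ∈ 𝓑.horizon, 𝓑.metric.val p (K p) (K p) = 0)
    (hKc : ∀ x ∈ U ∩ 𝓑.doc, 𝓑.metric.val x (K x) (K x) ≤ 0) {p : 𝓑.carrier} (hp : p ∈ 𝓑.horizon)
    {v : TangentSpace (𝓡 4) p} (hv : 𝓑.metric.val p v v < 0)
    (hvT : 𝓑.metric.val p (𝓑.timeOrientation.vectorField p) v < 0) :
    0 ≤ 2 * 𝓑.metric.val p (𝓑.metric.leviCivita K p v) (K p) := by
  have hpU : p ∈ U := hHU hp
  have hpfr : p ∈ frontier (𝓑.metric.chronologicalPast 𝓑.timeOrientation 𝓑.Mext) := hp.1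
  have hpfut : p ∈ 𝓑.metric.chronologicalFuture 𝓑.timeOrientation 𝓑.Mext := hp.2
  obtain ⟨c, ε, δ, hε, hδ, hc0, hcv, hc1, hctl⟩ :=
    exists_isFutureTimelikeCurveOn_of_isTimelike 𝓑.metric 𝓑.timeOrientation
      (BoundarylessManifold.isInteriorPoint (I := 𝓡 4)) hv hvT
  subst hc0
  have hKd := hKon.mdifferentiableAt hU hpU
  have hcd : MDifferentiableAt 𝓘(ℝ, ℝ) (𝓡 4) c 0 := hc1.mdifferentiableAt one_ne_zero
  have hlift := mdifferentiableAt_lift_comp (I := 𝓡 4) (X := K) (γ := c) (t₀ := 0) hKd hcd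
  have hcov : 𝓑.metric.toPseudoRiemannianMetric.IsCompatible 𝓑.metric.leviCivita :=
    (PseudoRiemannianMetric.isLeviCivita_leviCivita_holds
      (g := 𝓑.metric.toPseudoRiemannianMetric)).2
  have hD := 𝓑.metric.toPseudoRiemannianMetric.hasDerivAt_val_apply_along hcov hlift hlift
  rw [covariantDerivAlong_comp_holds 𝓑.metric.leviCivita hcd hKd, hcv] at hD
  have hderiv : HasDerivAt (fun t ↦ 𝓑.metric.val (c t) (K (c t)) (K (c t)))
      (δ * (2 * 𝓑.metric.val (c 0) (𝓑.metric.leviCivita K (c 0) v) (K (c 0)))) 0 := by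
    convert hD using 1
    rw [map_smul, 𝓑.metric.symm (c 0) (K (c 0))]
    simp only [map_smul, FunLike.coe_smul, Pi.smul_apply, smul_eq_mul]
    ring
  have h0 : 𝓑.metric.val (c 0) (K (c 0)) (K (c 0)) = 0 := hnull _ hp
  have hleft : ∀ᶠ t in 𝓝[<] (0 : ℝ), 𝓑.metric.val (c t) (K (c t)) (K (c t)) ≤ 0 := by
    have hopen : IsOpen (U ∩ 𝓑.metric.chronologicalFuture 𝓑.timeOrientation 𝓑.Mext) :=
      hU.inter (LorentzianMetric.isOpen_chronologicalFuture_of_boundaryless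
        𝓑.metric 𝓑.timeOrientation _)
    have hmem : ∀ᶠ t in 𝓝 (0 : ℝ),
        c t ∈ U ∩ 𝓑.metric.chronologicalFuture 𝓑.timeOrientation 𝓑.Mext :=
      hc1.continuous.continuousAt.preimage_mem_nhds (hopen.mem_nhds ⟨hpU, hpfut⟩)
    have hIoo : ∀ᶠ t in 𝓝[<] (0 : ℝ), t ∈ Ioo (-ε) 0 := Ioo_mem_nhdsLT (by linarith)
    filter_upwards [nhdsWithin_le_nhds hmem, hIoo] with t htUF ht
    obtain ⟨htU, htF⟩ := htUF
    refine hKc (c t) ⟨htU, htF, ?_⟩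
    have hpt : c 0 ∈ 𝓑.metric.chronologicalFuture 𝓑.timeOrientation {c t} :=
      ⟨c t, rfl, c, t, 0, ht.2, hctl.mono (Icc_subset_Ioo ht.1 hε), rfl, rfl⟩
    obtain ⟨p', hp'F, hp'P⟩ :
        (𝓑.metric.chronologicalFuture 𝓑.timeOrientation {c t} ∩
          𝓑.metric.chronologicalPast 𝓑.timeOrientation 𝓑.Mext).Nonempty :=
      mem_closure_iff_nhds.mp (frontier_subset_closure hpfr) _
        ((LorentzianMetric.isOpen_chronologicalFuture_of_boundaryless 𝓑.metric
          𝓑.timeOrientation {c t}).mem_nhds hpt)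
    exact LorentzianMetric.mem_chronologicalPast_trans hp'P
      (LorentzianMetric.mem_chronologicalPast_of_mem_chronologicalFuture hp'F)
  have hsign := deriv_nonneg_of_nonpos_left hderiv h0 hleft
  exact nonneg_of_mul_nonneg_right hsign hδ

/-- **Step B2: near a non-degenerate horizon point the zeros of `g(K, K)` lie on the horizon.**
For the Killing–timelike collar `(U, K)` of crux `HawkingExtensionIsKerr` (strict sign
`g(K, K) < 0` on `U ∩ ⟨⟨M_ext⟩⟩`) and `p ∈ 𝓔⁺` with `∇_K K = κ K`, `κ ≠ 0`, `K_p ≠ 0`: every zero of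
`f = g(K, K)` close enough to `p` is a point of `𝓔⁺`. -/
theorem eventually_mem_horizon_of_val_self_eq_zero (𝓑 : StationaryAFBlackHole.{0})
    [𝓑.metric.HasLeviCivita] {U : Set 𝓑.carrier} {K : Π x : 𝓑.carrier, TangentSpace (𝓡 4) x}
    (hU : IsOpen U) (hHU : 𝓑.horizon ⊆ U)
    (hKon : 𝓑.metric.toPseudoRiemannianMetric.IsKillingFieldOn K U)
    (hnull : ∀ p ∈ 𝓑.horizon, 𝓑.metric.val p (K p) (K p) = 0)
    (hKtl : ∀ x ∈ U ∩ 𝓑.doc, 𝓑.metric.val x (K x) (K x) < 0) {p : 𝓑.carrier} (hp : p ∈ 𝓑.horizon)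
    {κ : ℝ} (hκ : κ ≠ 0) (hκK : 𝓑.metric.leviCivita K p (K p) = κ • K p) (hKp : K p ≠ 0) :
    ∀ᶠ y in 𝓝 p, 𝓑.metric.val y (K y) (K y) = 0 → y ∈ 𝓑.horizon := by
  -- notation and standing facts
  set g := 𝓑.metric.toPseudoRiemannianMetric with hgdef
  set Y : Π x : 𝓑.carrier, TangentSpace (𝓡 4) x := 𝓑.timeOrientation.vectorField with hYdef
  set P : Set 𝓑.carrier := 𝓑.metric.chronologicalPast 𝓑.timeOrientation 𝓑.Mext with hPdef
  set F : Set 𝓑.carrier := 𝓑.metric.chronologicalFuture 𝓑.timeOrientation 𝓑.Mext with hFdef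
  have hPopen : IsOpen P :=
    LorentzianMetric.isOpen_chronologicalPast_of_boundaryless 𝓑.metric 𝓑.timeOrientation _
  have hFopen : IsOpen F :=
    LorentzianMetric.isOpen_chronologicalFuture_of_boundaryless 𝓑.metric 𝓑.timeOrientation _
  have hpU : p ∈ U := hHU hp
  have hpfr : p ∈ frontier P := hp.1
  have hpF : p ∈ F := hp.2
  have hLC : g.IsLeviCivita g.leviCivita := PseudoRiemannianMetric.isLeviCivita_leviCivita_holds
  have hY : ContMDiff (𝓡 4) (𝓡 4).tangent ∞
      (fun x ↦ (⟨x, Y x⟩ : TangentBundle (𝓡 4) 𝓑.carrier)) := 𝓑.timeOrientation.contMDiff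
  -- the derivative of `f` along `Y`: `D y = g(∇_{Y y} K, K y)`, continuous on `U`, positive at `p`
  set D : 𝓑.carrier → ℝ := fun y ↦ 𝓑.metric.val y (𝓑.metric.leviCivita K y (Y y)) (K y) with hDdef
  have hDcont : ContinuousOn D U := by
    have hcov : g.leviCivita.IsLocallyContMDiff 0 :=
      g.isLocallyContMDiff_leviCivita_holds 0 (by exact_mod_cast le_top)
    have h4 : ContMDiffOn (𝓡 4) 𝓘(ℝ, ℝ) 0 D U := by
      intro y hy
      have h1 := ((hcov U hU).contMDiff (hKon.1.of_le (by exact_mod_cast le_top))) y hy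
      have h2 : ContMDiffWithinAt (𝓡 4) (𝓡 4).tangent 0
          (fun z ↦ (⟨z, 𝓑.metric.leviCivita K z (Y z)⟩ : TangentBundle (𝓡 4) 𝓑.carrier)) U y :=
        h1.clm_bundle_apply ((hY y).of_le bot_le).contMDiffWithinAt
      have h3 : ContMDiffWithinAt (𝓡 4) (𝓡 4).tangent 0
          (fun z ↦ (⟨z, K z⟩ : TangentBundle (𝓡 4) 𝓑.carrier)) U y := (hKon.1 y hy).of_le bot_le
      have hg0 : ContMDiffWithinAt (𝓡 4) ((𝓡 4).prod 𝓘(ℝ, E4 →L[ℝ] E4 →L[ℝ] ℝ)) 0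
          (fun b ↦ TotalSpace.mk' (E4 →L[ℝ] E4 →L[ℝ] ℝ) b (𝓑.metric.val b)) U y :=
        ((𝓑.metric.contMDiff y).of_le bot_le).contMDiffWithinAt
      have := hg0.clm_bundle_apply₂ (F₁ := E4) (F₂ := E4) h2 h3
      simp only [contMDiffWithinAt_totalSpace] at this
      exact this.2
    exact contMDiffOn_zero_iff.mp h4
  -- `2 D p = df_p(Y p) > 0`
  have hDp : 0 < D p := by
    have hnn := two_mul_val_leviCivita_self_nonneg_of_collar 𝓑 hU hHU hKon hnull
      (fun x hx ↦ (hKtl x hx).le) hp (𝓑.timeOrientation.isTimelike p)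
      (𝓑.timeOrientation.isTimelike p)
    -- `g(∇_{Y} K, K)(p) = -κ g(K, Y)(p) ≠ 0`
    have hKill := hKon.val_leviCivita_add hpU (Y p) (K p)
    rw [hκK, map_smul, smul_eq_mul, 𝓑.metric.symm p (Y p) (K p)] at hKill
    have hKY : 𝓑.metric.val p (K p) (Y p) ≠ 0 := by
      intro h0
      have hpos := 𝓑.metric.pos_of_orthogonal p (Y p) (K p) (𝓑.timeOrientation.isTimelike p)
        (by rw [𝓑.metric.symm]; exact h0) hKp
      rw [hnull p hp] at hpos
      exact lt_irrefl _ hpos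
    have hne : D p ≠ 0 := by
      intro hD0
      have hD0' : 𝓑.metric.val p (𝓑.metric.leviCivita K p (Y p)) (K p) = 0 := hD0
      rw [hD0', zero_add] at hKill
      exact hKY ((mul_eq_zero.mp hKill).resolve_left hκ)
    rcases (lt_or_gt_of_ne hne) with hlt | hgt
    · exact absurd hnn (by change ¬ 0 ≤ 2 * D p; linarith)
    · exact hgt
  -- the good open set `G = {y ∈ U | D y > 0} ∩ I⁺(M_ext)`
  have hGopen : IsOpen ((U ∩ D ⁻¹' Ioi 0) ∩ F) :=
    (hDcont.isOpen_inter_preimage hU isOpen_Ioi).inter hFopen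
  have hpG : p ∈ (U ∩ D ⁻¹' Ioi 0) ∩ F := ⟨⟨hpU, hDp⟩, hpF⟩
  -- flow box of `Y` about `p`
  have hYp : Y p ≠ 0 := (𝓑.timeOrientation.isTimelike p).ne_zero
  obtain ⟨ψ, hψ, hpψ, -, -, hψv⟩ :=
    exists_chart_mfderiv_eq_const (V := Y) isOpen_univ (hY.contMDiffOn (s := univ)) (mem_univ p) hYp
  set v : E4 := Y p with hvdef
  -- a ball about `ψ p` inside the target whose preimage lies in `G`
  have hψpt : ψ p ∈ ψ.target := ψ.map_source hpψ
  have hsymm_cont : ContinuousAt ψ.symm (ψ p) := ψ.continuousAt_symm hψpt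
  obtain ⟨r, hr, hrt, hrG⟩ : ∃ r > 0, ball (ψ p) r ⊆ ψ.target ∧
      ∀ z ∈ ball (ψ p) r, ψ.symm z ∈ (U ∩ D ⁻¹' Ioi 0) ∩ F := by
    have h1 : ∀ᶠ z in 𝓝 (ψ p), z ∈ ψ.target := ψ.open_target.mem_nhds hψpt
    have h2 : ∀ᶠ z in 𝓝 (ψ p), ψ.symm z ∈ (U ∩ D ⁻¹' Ioi 0) ∩ F :=
      hsymm_cont.preimage_mem_nhds (by rw [ψ.left_inv hpψ]; exact hGopen.mem_nhds hpG)
    obtain ⟨r, hr, h⟩ := Metric.eventually_nhds_iff_ball.mp (h1.and h2)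
    exact ⟨r, hr, fun z hz ↦ (h z hz).1, fun z hz ↦ (h z hz).2⟩
  -- the box `N` and the time `ε`
  set ε : ℝ := r / (2 * (‖v‖ + 1)) with hε
  have hεpos : 0 < ε := by positivity
  have hεv : ε * ‖v‖ ≤ r / 2 := by
    rw [hε, div_mul_eq_mul_div, div_le_div_iff₀ (by positivity) two_pos]
    nlinarith [norm_nonneg v]
  set N : Set 𝓑.carrier := ψ.source ∩ ψ ⁻¹' ball (ψ p) (r / 2) with hN
  have hNopen : IsOpen N := ψ.isOpen_inter_preimage isOpen_ball
  have hpN : p ∈ N := ⟨hpψ, mem_ball_self (half_pos hr)⟩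
  have hseg : ∀ x ∈ N, ∀ s ∈ Ioo (-ε) ε, ψ x + s • v ∈ ball (ψ p) r := by
    intro x hx s hs
    rw [mem_ball, dist_eq_norm]
    have h1 : ‖ψ x - ψ p‖ < r / 2 := by rw [← dist_eq_norm]; exact hx.2
    have h2 : ‖s • v‖ ≤ ε * ‖v‖ := by
      rw [norm_smul, Real.norm_eq_abs]
      exact mul_le_mul_of_nonneg_right (abs_lt.2 hs).le (norm_nonneg v)
    calc ‖ψ x + s • v - ψ p‖ = ‖(ψ x - ψ p) + s • v‖ := by congr 1; abel
      _ ≤ ‖ψ x - ψ p‖ + ‖s • v‖ := norm_add_le _ _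
      _ < r / 2 + r / 2 := by linarith
      _ = r := by ring
  -- the lines `γ x s = ψ⁻¹ (ψ x + s v)`: integral curves of `Y`, in `G`, with `f` increasing
  set γ : 𝓑.carrier → ℝ → 𝓑.carrier := fun x s ↦ ψ.symm (ψ x + s • v) with hγdef
  have hγint : ∀ x ∈ N, IsMIntegralCurveOn (γ x) Y (Ioo (-ε) ε) := fun x hx ↦
    isMIntegralCurveOn_symm_add_smul hψ hψv fun s hs ↦ hrt (hseg x hx s hs)
  have hγG : ∀ x ∈ N, ∀ s ∈ Ioo (-ε) ε, γ x s ∈ (U ∩ D ⁻¹' Ioi 0) ∩ F := fun x hx s hs ↦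
    hrG _ (hseg x hx s hs)
  have hγd : ∀ x ∈ N, ∀ s ∈ Ioo (-ε) ε,
      HasMFDerivAt 𝓘(ℝ, ℝ) (𝓡 4) (γ x) s ((1 : ℝ →L[ℝ] ℝ).smulRight (Y (γ x s))) :=
    fun x hx s hs ↦ (hγint x hx s hs).hasMFDerivAt (Ioo_mem_nhds hs.1 hs.2)
  have hγtl : ∀ x ∈ N, 𝓑.metric.IsFutureTimelikeCurveOn 𝓑.timeOrientation (γ x) (Ioo (-ε) ε) := by
    intro x hx s hs
    have hd := hγd x hx s hs
    have hvel : velocity (𝓡 4) (γ x) s = Y (γ x s) := velocity_eq_of_hasMFDerivAt' hd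
    refine ⟨hd.mdifferentiableAt, ?_, ?_⟩
    · rw [hvel]; exact 𝓑.timeOrientation.isTimelike _
    · rw [hvel]; exact 𝓑.timeOrientation.isFutureDirected_vectorField _
  have hγmono : ∀ x ∈ N, StrictMonoOn (fun s ↦ 𝓑.metric.val (γ x s) (K (γ x s)) (K (γ x s)))
      (Ioo (-ε) ε) := by
    intro x hx
    have hderiv : ∀ s ∈ Ioo (-ε) ε, HasDerivAt (fun s ↦ 𝓑.metric.val (γ x s) (K (γ x s)) (K (γ x s)))
        (2 * D (γ x s)) s := by
      intro s hs
      obtain ⟨⟨hsU, -⟩, -⟩ := hγG x hx s hs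
      have hKs := hKon.mdifferentiableAt hU hsU
      have hYs := (hY (γ x s)).mdifferentiableAt (by simp)
      have hfd : MDifferentiableAt (𝓡 4) 𝓘(ℝ, ℝ) (fun y ↦ 𝓑.metric.val y (K y) (K y)) (γ x s) :=
        g.mdifferentiableAt_val_apply hKs hKs
      have h := hasDerivAt_comp_curve (I := 𝓡 4) hfd (hγd x hx s hs).mdifferentiableAt
      rw [velocity_eq_of_hasMFDerivAt' (hγd x hx s hs)] at h
      have hc : mvfderiv (𝓡 4) (fun y ↦ 𝓑.metric.val y (K y) (K y)) (γ x s) (Y (γ x s)) =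
          𝓑.metric.val (γ x s) (𝓑.metric.leviCivita K (γ x s) (Y (γ x s))) (K (γ x s))
            + 𝓑.metric.val (γ x s) (K (γ x s)) (𝓑.metric.leviCivita K (γ x s) (Y (γ x s))) :=
        hLC.2 hYs hKs hKs
      have hc' : mfderiv (𝓡 4) 𝓘(ℝ, ℝ) (fun y ↦ 𝓑.metric.val y (K y) (K y)) (γ x s) (Y (γ x s)) =
          2 * D (γ x s) := by
        change mvfderiv (𝓡 4) (fun y ↦ 𝓑.metric.val y (K y) (K y)) (γ x s) (Y (γ x s)) = _
        rw [hc, 𝓑.metric.symm (γ x s) (K (γ x s))]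
        change _ = 2 * 𝓑.metric.val (γ x s) (𝓑.metric.leviCivita K (γ x s) (Y (γ x s))) (K (γ x s))
        ring
      rwa [hc'] at h
    refine strictMonoOn_of_hasDerivWithinAt_pos (convex_Ioo _ _)
      (fun s hs ↦ (hderiv s hs).continuousAt.continuousWithinAt) (f' := fun s ↦ 2 * D (γ x s))
      (fun s hs ↦ ?_) (fun s hs ↦ ?_)
    · rw [interior_Ioo] at hs
      exact (hderiv s hs).hasDerivWithinAt
    · rw [interior_Ioo] at hs
      obtain ⟨⟨-, hDs⟩, -⟩ := hγG x hx s hs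
      have : 0 < D (γ x s) := hDs
      positivity
  -- the past anchor time `t₀` and the set of admissible starting points
  set t₀ : ℝ := -(ε / 2) with ht₀
  have ht₀mem : t₀ ∈ Ioo (-ε) ε := by constructor <;> linarith
  have ht₀neg : t₀ < 0 := by linarith
  have hcontN : ContinuousOn (fun x ↦ γ x t₀) N := by
    intro x hx
    have h1 : ContinuousWithinAt ψ N x := (ψ.continuousAt hx.1).continuousWithinAt
    have h2 : ContinuousAt ψ.symm (ψ x + t₀ • v) := ψ.continuousAt_symm (hrt (hseg x hx t₀ ht₀mem))
    have h3 : ContinuousWithinAt (fun x ↦ ψ x + t₀ • v) N x := h1.add continuousWithinAt_const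
    exact ContinuousAt.comp_continuousWithinAt (f := fun x' ↦ ψ x' + t₀ • v) h2 h3
  -- `γ p t₀ ∈ I⁻(M_ext)`
  have hγpt₀ : γ p t₀ ∈ P := by
    have hcurve : 𝓑.metric.IsFutureTimelikeCurveOn 𝓑.timeOrientation (γ p) (Icc t₀ 0) :=
      (hγtl p hpN).mono (Icc_subset_Ioo ht₀mem.1 hεpos)
    have hp0 : γ p 0 = p := by simp [hγdef, ψ.left_inv hpψ]
    have hpt : p ∈ 𝓑.metric.chronologicalFuture 𝓑.timeOrientation {γ p t₀} :=
      ⟨γ p t₀, rfl, γ p, t₀, 0, ht₀neg, hcurve, rfl, hp0⟩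
    obtain ⟨p', hp'F, hp'P⟩ :
        (𝓑.metric.chronologicalFuture 𝓑.timeOrientation {γ p t₀} ∩ P).Nonempty :=
      mem_closure_iff_nhds.mp (frontier_subset_closure hpfr) _
        ((LorentzianMetric.isOpen_chronologicalFuture_of_boundaryless 𝓑.metric
          𝓑.timeOrientation {γ p t₀}).mem_nhds hpt)
    exact LorentzianMetric.mem_chronologicalPast_trans hp'P
      (LorentzianMetric.mem_chronologicalPast_of_mem_chronologicalFuture hp'F)
  have hN'open : IsOpen (N ∩ (fun x ↦ γ x t₀) ⁻¹' P) := hcontN.isOpen_inter_preimage hNopen hPopen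
  have hpN' : p ∈ N ∩ (fun x ↦ γ x t₀) ⁻¹' P := ⟨hpN, hγpt₀⟩
  -- the endgame
  filter_upwards [hN'open.mem_nhds hpN'] with y hy hfy
  obtain ⟨hyN, hyt₀⟩ := hy
  have hy0 : γ y 0 = y := by simp [hγdef, ψ.left_inv hyN.1]
  have hγy_cont : ContinuousOn (γ y) (Ioo (-ε) ε) := fun s hs ↦
    (hγd y hyN s hs).continuousAt.continuousWithinAt
  -- `S = {t ∈ [t₀, 0] | γ y t ∈ closure P}` and its maximum `t*`
  set S : Set ℝ := Icc t₀ 0 ∩ (γ y) ⁻¹' closure P with hSdef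
  have hIcc : Icc t₀ 0 ⊆ Ioo (-ε) ε := Icc_subset_Ioo ht₀mem.1 hεpos
  have hSclosed : IsClosed S :=
    (hγy_cont.mono hIcc).preimage_isClosed_of_isClosed isClosed_Icc isClosed_closure
  have ht₀S : t₀ ∈ S := ⟨⟨le_rfl, ht₀neg.le⟩, subset_closure hyt₀⟩
  have hSbdd : BddAbove S := ⟨0, fun t ht ↦ ht.1.2⟩
  set ts := sSup S with hts
  have htsS : ts ∈ S := hSclosed.csSup_mem ⟨t₀, ht₀S⟩ hSbdd
  have hts0 : ts ≤ 0 := htsS.1.2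
  have htst₀ : t₀ ≤ ts := htsS.1.1
  have htsmem : ts ∈ Ioo (-ε) ε := hIcc htsS.1
  -- points of `G` on the line in the closure of `P` but not in `P` are horizon points, where `f = 0`
  have hhor : ∀ t ∈ Icc t₀ 0, γ y t ∈ closure P → γ y t ∉ P → γ y t ∈ 𝓑.horizon := by
    intro t ht hcl hnP
    have hfr : γ y t ∈ frontier P := by
      rw [hPopen.frontier_eq]; exact ⟨hcl, hnP⟩
    exact ⟨hfr, (hγG y hyN t (hIcc ht)).2⟩
  by_cases hts_zero : ts = 0
  · -- `y` itself is in the closure of `P`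
    have hycl : y ∈ closure P := by rw [← hy0, ← hts_zero]; exact htsS.2
    have hynP : y ∉ P := by
      intro hyP
      have hyG := hγG y hyN 0 (by constructor <;> linarith)
      rw [hy0] at hyG
      have := hKtl y ⟨hyG.1.1, hyG.2, hyP⟩
      rw [hfy] at this
      exact lt_irrefl _ this
    have h := hhor 0 ⟨ht₀neg.le, le_rfl⟩ (by rwa [hy0]) (by rwa [hy0])
    rwa [hy0] at h
  · exfalso
    have hts_neg : ts < 0 := lt_of_le_of_ne hts0 hts_zero
    by_cases hzP : γ y ts ∈ P
    · -- openness of `P` contradicts maximality of `ts`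
      have hev : ∀ᶠ t in 𝓝 ts, γ y t ∈ P :=
        (hγd y hyN ts htsmem).continuousAt.preimage_mem_nhds (hPopen.mem_nhds hzP)
      obtain ⟨δ, hδ, hδP⟩ := Metric.eventually_nhds_iff_ball.mp hev
      set t' := min (ts + δ / 2) 0 with ht'
      have ht'gt : ts < t' := lt_min (by linarith) hts_neg
      have ht'S : t' ∈ S := by
        refine ⟨⟨by linarith [min_le_right (ts + δ / 2) (0:ℝ), le_min (by linarith) hts0], min_le_right _ _⟩,
          subset_closure (hδP t' ?_)⟩
        rw [mem_ball, Real.dist_eq, abs_lt]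
        constructor <;> linarith [min_le_left (ts + δ / 2) (0:ℝ)]
      exact absurd (le_csSup hSbdd ht'S) (not_le.mpr ht'gt)
    · -- a horizon point strictly before `y` on the line: `f = 0` there, but `f` increases
      have hzH := hhor ts htsS.1 htsS.2 hzP
      have hfz : 𝓑.metric.val (γ y ts) (K (γ y ts)) (K (γ y ts)) = 0 := hnull _ hzH
      have hlt : 𝓑.metric.val (γ y ts) (K (γ y ts)) (K (γ y ts)) <
          𝓑.metric.val (γ y 0) (K (γ y 0)) (K (γ y 0)) :=
        hγmono y hyN htsmem (by constructor <;> linarith : (0:ℝ) ∈ Ioo (-ε) ε) hts_neg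
      rw [hfz, hy0, hfy] at hlt
      exact lt_irrefl _ hlt


/-- **Registered sub-goal form of step B** (closed statement, crux stmt-FinalStateConjecture-17840):
near a non-degenerate horizon point the zeros of `g(K, K)` lie on the horizon. -/
theorem stub_horizon_levelSet : ∀ (𝓑 : StationaryAFBlackHole.{0}) [𝓑.metric.HasLeviCivita] (U : Set 𝓑.carrier) (K : Π x : 𝓑.carrier, TangentSpace (𝓡 4) x), IsOpen U → 𝓑.horizon ⊆ U → 𝓑.metric.toPseudoRiemannianMetric.IsKillingFieldOn K U → (∀ p ∈ 𝓑.horizon, 𝓑.metric.val p (K p) (K p) = 0) → (∀ x ∈ U ∩ 𝓑.doc, 𝓑.metric.val x (K x) (K x) < 0) → ∀ p ∈ 𝓑.horizon, ∀ κ : ℝ, κ ≠ 0 → 𝓑.metric.leviCivita K p (K p) = κ • K p → K p ≠ 0 → ∀ᶠ y in 𝓝 p, 𝓑.metric.val y (K y) (K y) = 0 → y ∈ 𝓑.horizon :=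
  fun 𝓑 _ _ _ hU hHU hKon hnull hKtl _ hp _ hκ hκK hKp ↦
    eventually_mem_horizon_of_val_self_eq_zero 𝓑 hU hHU hKon hnull hKtl hp hκ hκK hKp

end Summit.FinalStateConjecture.FinalStateConjecture.Theorems.HawkingExtensionIsKerr.SketchIdeator2

end
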